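import Literature.MathematicalPhysics.QuantumFieldTheory.Balaban1983to89.B1Sect3Statements
import Literature.MathematicalPhysics.QuantumFieldTheory.Balaban1983to89.B1GaussNorm331

/-!
# `Balaban1983to89.B1Eq346DetFactorization` — [Balaban1982Higgs1] (3.46) p. 620 (= [Balaban1982Higgs2] (2.101) p. 577,
(3.18) p. 586): the DETERMINANT FACTORIZATION through the operator square root, with (3.47) in its printed trace form and
[Balaban1982Higgs2] (2.100), (2.102) — PROVED for real symmetric matrices (Mathlib `CFC.sqrt`, spectral theorem)

statement-level skeleton of published theorems with citation tags; proofs where landed; nothing here is a claim about the Yang–Mills mass gap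

CITATION HEADER.  T. Bałaban, *(Higgs)₂,₃ quantum fields in a finite volume. I. A lower bound*, Commun. Math. Phys. **85**
(1982) 603–626, doi:10.1007/bf01403506 [Balaban1982Higgs1] (cell paper B1; PDF held `paper:balaban1982-cmp85-higgs23-i`,
journal page = PDF page + 602); *II. An upper bound*, Commun. Math. Phys. **86** (1982) 555–594, doi:10.1007/bf01214890
[Balaban1982Higgs2] (cell paper B2; PDF held `paper:balaban1982-cmp86-higgs23-ii`, journal page = PDF page + 554).  The
displays below were READ AS IMAGES on the ×2 renders `run/shared/lean/pub/pub-balaban/b2b-balaban-ref1/pages/1982-cmp85-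
higgs23-I/…-p018-x2.png` (p. 620) and `…/1982-cmp86-higgs23-II/…-p023, p024, p032, p033-x2.png` (pp. 577, 578, 586, 587).
Unit `lit-balaban-p04` gen 3 (Phase-2 proof seat; HOME `run/shared/lean/pub/lit-balaban/`, seat dir `lit-balaban-p04/`);
SKELETON rows **B1.Eq3.46** (the factorization (3.46); the (3.47) half is `B1LowerBound.Ineq347` (r14) PROVED by
`B1Sect3Statements.ineq347_of_posDef` (r12) — REUSED here, not restated), **B2.Eq2.103** (members (2.100)–(2.102); the
member (2.103) and **B2.Eq3.20** (3.19)–(3.20) are the sibling `…B2Ineq2103LogDet`), **B2.Eq3.20** (member (3.18)).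
Referee ref-4; fold owners r14/r12 (B1), r02/r14 (B2).

WHAT IS PRINTED (verbatim).  **I p. 620**: *"Taking into account the form (3.40) of this factor it is sufficient to find an
expansion of (det G_k⁻¹(A′^{(k)} + B^{(k+1)}))^{−1/2}. Using the formula (3.16) we get (det G_k(A′^{(k)} + B^{(k+1)})⁻¹)^{−1/2} =
(det G_k(B^{(k+1)})⁻¹)^{−1/2}[det(I − G_k(B^{(k+1)})^{1/2}V_kG_k(B^{(k+1)})^{1/2})]^{−1/2}. (3.46) Obviously the operators
standing in the above determinants are positive and symmetric. Thus the inequality log(1 + λ) ≦ λ − λ²/2 + λ³/3 + … +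
(−1)^{n−1}λⁿ/n holding for n odd and λ real, λ > −1, implies the following inequality for the second determinant on the right
side of (3.46): [det(I − G_k(B^{(k+1)})^{1/2}V_kG_k(B^{(k+1)})^{1/2})]^{−1/2} ≧ exp Σ_{j=1}^{n} (1/2j) Tr(G_k(B^{(k+1)})V_k)^j. (3.47)"*
((3.16)/(3.44) p. 615/619: `G_k(Ω,A+B)⁻¹ = G_k(Ω,B)⁻¹ − V_k`, kernel-checked in `…Balaban1983to89.B1` as `B1.resolvent_of_diff`).
**II p. 577**: *"The formula (2.99) implies (C(B̃ + Ã))⁻¹ = (C(B̃))^{−1/2}(I − (C(…))^{1/2}W^{(j)}(C(…))^{1/2})(C(…))^{−1/2}, (2.100)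
hence [det(C(B̃ + Ã))⁻¹]^{−1/2} = [det(C(B̃))⁻¹]^{−1/2}·[det(I − (C(…))^{1/2}W^{(j)}(C(…))^{1/2})]^{−1/2}. (2.101) … hence we
can apply Proposition I.2.3 and we get (γ₀/γ₁)I ≦ I − (C(…))^{1/2}W^{(j)}(C(…))^{1/2} = (C(…))^{1/2}(C(B̃ + Ã))⁻¹(C(…))^{1/2} ≦
(γ₁/γ₀)I. (2.102)"* (C = C^{(j)}_{Λ₅^{(j)}}(B^j(Λ₂^{(j)}), ·); (2.99): `(C(B̃+Ã))⁻¹ = (C(B̃))⁻¹ − W^{(j)}(Ã,B̃)`).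
**II p. 586**: *"Let us consider the determinants in (3.17). We have [det(G′_k − H′_k)]^{−1/2} = (det G′_k)^{−1/2}
[det(I − G′_k^{−1/2}H′_kG′_k^{−1/2})]^{−1/2}, (3.18)"* (p. 586: *"the operators G′_k − H′_k and G″_k − H″_k are positive"*).

MODEL.  Operators = real matrices on a finite index type `ι` (↤ the lattice Λ / T₁^{(k)} with its internal indices);
*"positive and symmetric"* = `Matrix.PosDef`; the operator square root `X^{1/2}` = Mathlib's `CFC.sqrt X`, `X^{−1/2}` =
`CFC.sqrt X⁻¹ = (CFC.sqrt X)⁻¹` (`sqrt_inv_eq`); *"(γ₀/γ₁)I ≦ X ≦ (γ₁/γ₀)I"* = positive semidefiniteness of the differences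
(Loewner order); the relation between the two propagators — (3.16) in I, (2.99) in II — enters as the HYPOTHESIS
`G₁⁻¹ = G₀⁻¹ − V`.  THEOREMS ONLY (no `def`, no new `Prop` fact); axioms standard.

WHAT THIS MODULE PROVES.  §0 toolkit (`CFC.sqrt` of a positive definite real matrix; `trace_mul_pow_comm` Tr(AB)^m = Tr(BA)^m;
eigenvalue bounds from Loewner bounds).  §1 the engine for `P ≻ 0` and any `H`: `det(P − H) = det P · det(I − P^{−1/2}HP^{−1/2})`
(`det_sub_eq`), `P − H = P^{1/2}(I − P^{−1/2}HP^{−1/2})P^{1/2}` (`sub_eq_sqrt_conj`), `I − P^{−1/2}HP^{−1/2} = P^{−1/2}(P − H)P^{−1/2} ≻ 0`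
when `P − H ≻ 0` (`posDef_one_sub_conj`), inverse Loewner bounds (`inv_lower`, `inv_upper`).  §2 **(3.46)** `eq346_det`, `eq346`
(the printed `−1/2`-power form, `Real.rpow`), the p. 620 positivity/symmetry sentence `posDef_one_sub346`/`isHermitian_K346`,
**(3.47) as printed** `ineq347_printed` (trace form `Tr(G_kV_k)^j`, by cyclicity `trace_pow_eq346` + r12's `ineq347_of_posDef`),
and the product `eq346_ineq347`.  §3 **(2.100)** `eq2100`, **(2.101)** `eq2101`, **(2.102)** `eq2102` (the middle equality)
and `ineq2102` (the two-sided bound from `γ₀ ≦ C₀, C₁ ≦ γ₁`).  §4 **(3.18)** `eq318_det`, `eq318`.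
v1.1 (same seat, append-only): §5 the SENTENCE before (3.46) — *"Taking into account the form (3.40) of this factor it is
sufficient to find an expansion of (det G_k⁻¹(A′^{(k)} + B^{(k+1)}))^{−1/2}"* — made a theorem: the normalised Gaussian constant
`Z_k(A^{(k)})` of (3.32)/(3.40) (p12's `B1GaussNorm331.gaussNorm`/`ZkA`, closed form `c^{n/2}/√det`) FACTORIZES through (3.46):
`Z_k(A′^{(k)} + B^{(k+1)}) = Z_k(B^{(k+1)})·[det(I − G₀^{1/2}V_kG₀^{1/2})]^{−1/2}` (`gaussNorm_eq346`, `ZkA_eq346`) and, with (3.47),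
`Z_k(A′^{(k)} + B^{(k+1)}) ≧ Z_k(B^{(k+1)})·exp Σ_{j≤n}(1/2j)Tr(G₀V_k)^j` (`gaussNorm_ineq347`).
v1.2 (same seat, append-only): §6 **(3.69) p. 625 for the PRINTED operator** `a_K(L^Kε)^{d−2}P_KG^ε` — a product of two positive
operators, NOT symmetric in general: r12's `B1Sect3Statements.ineq369_of_posSemidef` (the predicate `Ineq369 X` for symmetric `X ⪰ 0`)
is transported to `X = a·PG` (`G ≻ 0`, `P ⪰ 0`, `a ≥ 0`) by the same square-root conjugation: `det(I + aPG) = det(I + aG^{1/2}PG^{1/2})`,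
`Tr(PG) = Tr(G^{1/2}PG^{1/2})` (`det_one_add_mul_eq`, `trace_mul_eq`, `ineq369_printed`).
-/

open scoped BigOperators MatrixOrder
open Finset Matrix

namespace Literature.MathematicalPhysics.QuantumFieldTheory.Balaban1983to89.B1Eq346DetFactorization

variable {ι : Type*} [Fintype ι] [DecidableEq ι]

/-! ## §0 Toolkit: the square root of a positive definite real matrix; cyclicity; eigenvalue bounds -/

section Toolkit

variable {P : Matrix ι ι ℝ}

/-- `P^{1/2}P^{1/2} = P` (the operator square root of (3.46) p. 620). [cite: Balaban1982Higgs1, (3.46) p.620] -/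
theorem sqrt_mul_sqrt (hP : P.PosDef) : CFC.sqrt P * CFC.sqrt P = P :=
  CFC.sqrt_mul_sqrt_self P hP.posSemidef.nonneg

/-- `P^{1/2}` is invertible for `P ≻ 0`. [cite: Balaban1982Higgs1, (3.46) p.620] -/
theorem isUnit_sqrt (hP : P.PosDef) : IsUnit (CFC.sqrt P) :=
  (CFC.isUnit_sqrt_iff P hP.posSemidef.nonneg).2 hP.isUnit

/-- `det P^{1/2}` is a unit. [cite: Balaban1982Higgs1, (3.46) p.620] -/
theorem isUnit_det_sqrt (hP : P.PosDef) : IsUnit (CFC.sqrt P).det :=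
  (Matrix.isUnit_iff_isUnit_det _).1 (isUnit_sqrt hP)

/-- `P^{1/2}` is symmetric (*"positive and symmetric"*, p. 620). [cite: Balaban1982Higgs1, (3.46) p.620] -/
theorem isHermitian_sqrt (P : Matrix ι ι ℝ) : (CFC.sqrt P).IsHermitian :=
  (CFC.sqrt_nonneg P).posSemidef.isHermitian

/-- `P^{−1/2}`: the square root of the inverse is the inverse of the square root. [cite: Balaban1982Higgs1, (3.46) p.620] -/
theorem sqrt_inv_eq (hP : P.PosDef) : CFC.sqrt P⁻¹ = (CFC.sqrt P)⁻¹ :=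
  (hP.posSemidef.inv_sqrt).symm

/-- `P^{−1/2}P^{−1/2} = P⁻¹`. [cite: Balaban1982Higgs1, (3.46) p.620] -/
theorem sqrt_inv_mul_sqrt_inv (hP : P.PosDef) : CFC.sqrt P⁻¹ * CFC.sqrt P⁻¹ = P⁻¹ :=
  sqrt_mul_sqrt hP.inv

/-- `P^{1/2}P^{−1/2} = I`. [cite: Balaban1982Higgs1, (3.46) p.620] -/
theorem sqrt_mul_sqrt_inv (hP : P.PosDef) : CFC.sqrt P * CFC.sqrt P⁻¹ = 1 := by
  rw [sqrt_inv_eq hP, Matrix.mul_nonsing_inv _ (isUnit_det_sqrt hP)]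

/-- `P^{−1/2}P^{1/2} = I`. [cite: Balaban1982Higgs1, (3.46) p.620] -/
theorem sqrt_inv_mul_sqrt (hP : P.PosDef) : CFC.sqrt P⁻¹ * CFC.sqrt P = 1 := by
  rw [sqrt_inv_eq hP, Matrix.nonsing_inv_mul _ (isUnit_det_sqrt hP)]

/-- `P^{−1/2}PP^{−1/2} = I`. [cite: Balaban1982Higgs1, (3.46) p.620] -/
theorem sqrt_inv_conj_self (hP : P.PosDef) : CFC.sqrt P⁻¹ * P * CFC.sqrt P⁻¹ = 1 := by
  calc CFC.sqrt P⁻¹ * P * CFC.sqrt P⁻¹ = CFC.sqrt P⁻¹ * (CFC.sqrt P * CFC.sqrt P) * CFC.sqrt P⁻¹ := by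
        rw [sqrt_mul_sqrt hP]
    _ = (CFC.sqrt P⁻¹ * CFC.sqrt P) * (CFC.sqrt P * CFC.sqrt P⁻¹) := by simp only [Matrix.mul_assoc]
    _ = 1 := by rw [sqrt_inv_mul_sqrt hP, sqrt_mul_sqrt_inv hP, Matrix.one_mul]

/-- Cyclicity under a power: `A(BA)^mB = (AB)^{m+1}`. [cite: Balaban1982Higgs1, (3.47) p.620] -/
theorem mul_pow_mul (A B : Matrix ι ι ℝ) (m : ℕ) : A * (B * A) ^ m * B = (A * B) ^ (m + 1) := by
  induction m with
  | zero => simp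
  | succ m ih =>
    calc A * (B * A) ^ (m + 1) * B = (A * (B * A) ^ m * B) * (A * B) := by
          rw [pow_succ]; simp only [Matrix.mul_assoc]
      _ = (A * B) ^ (m + 1 + 1) := by rw [ih, ← pow_succ]

/-- *"Tr(G_kV_k)^j"* = `Tr K^j` for `K = G_k^{1/2}V_kG_k^{1/2}` by cyclicity: `Tr(AB)^m = Tr(BA)^m`.
[cite: Balaban1982Higgs1, (3.47) p.620] -/
theorem trace_mul_pow_comm (A B : Matrix ι ι ℝ) (m : ℕ) : ((A * B) ^ m).trace = ((B * A) ^ m).trace := by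
  cases m with
  | zero => simp
  | succ m => rw [← mul_pow_mul A B m, Matrix.trace_mul_comm, ← Matrix.mul_assoc, ← pow_succ']

/-- Loewner upper bound ⇒ eigenvalue bound: `K ≦ aI` ⇒ `λ_i(K) ≤ a` (spectral theorem). [cite: Balaban1982Higgs2, (2.102) p.577] -/
theorem eigenvalues_le_of_posSemidef {K : Matrix ι ι ℝ} (hK : K.IsHermitian) {a : ℝ}
    (h : (a • (1 : Matrix ι ι ℝ) - K).PosSemidef) (i : ι) : hK.eigenvalues i ≤ a := by
  have e : a • (1 : Matrix ι ι ℝ) - K =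
      Unitary.conjStarAlgAut ℝ _ hK.eigenvectorUnitary (diagonal fun i => a - hK.eigenvalues i) := by
    conv_lhs => rw [hK.spectral_theorem]
    rw [← map_one (Unitary.conjStarAlgAut ℝ _ hK.eigenvectorUnitary), ← map_smul, ← map_sub, smul_one_eq_diagonal,
      diagonal_sub]
    rfl
  rw [e, Unitary.conjStarAlgAut_apply, (Matrix.IsUnit.posSemidef_star_right_conjugate_iff Unitary.isUnit_coe),
    posSemidef_diagonal_iff] at h
  linarith [h i]

/-- Loewner lower bound ⇒ eigenvalue bound: `aI ≦ K` ⇒ `a ≤ λ_i(K)`. [cite: Balaban1982Higgs2, (2.102) p.577] -/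
theorem le_eigenvalues_of_posSemidef {K : Matrix ι ι ℝ} (hK : K.IsHermitian) {a : ℝ}
    (h : (K - a • (1 : Matrix ι ι ℝ)).PosSemidef) (i : ι) : a ≤ hK.eigenvalues i := by
  have e : K - a • (1 : Matrix ι ι ℝ) =
      Unitary.conjStarAlgAut ℝ _ hK.eigenvectorUnitary (diagonal fun i => hK.eigenvalues i - a) := by
    conv_lhs => rw [hK.spectral_theorem]
    rw [← map_one (Unitary.conjStarAlgAut ℝ _ hK.eigenvectorUnitary), ← map_smul, ← map_sub, smul_one_eq_diagonal,
      diagonal_sub]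
    rfl
  rw [e, Unitary.conjStarAlgAut_apply, (Matrix.IsUnit.posSemidef_star_right_conjugate_iff Unitary.isUnit_coe),
    posSemidef_diagonal_iff] at h
  linarith [h i]

end Toolkit

/-! ## §1 The engine: factorization through `P^{±1/2}`, positivity, inverse bounds -/

section Engine

variable {P : Matrix ι ι ℝ}

/-- The determinant factorization behind (3.46)/(II.2.101)/(II.3.18): for `P ≻ 0` and any `H`,
`det(P − H) = det P · det(I − P^{−1/2}HP^{−1/2})`. [cite: Balaban1982Higgs1, (3.46) p.620] -/
theorem det_sub_eq (hP : P.PosDef) (H : Matrix ι ι ℝ) :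
    (P - H).det = P.det * (1 - CFC.sqrt P⁻¹ * H * CFC.sqrt P⁻¹).det := by
  have hPu : IsUnit P.det := (Matrix.isUnit_iff_isUnit_det _).1 hP.isUnit
  have h1 : P - H = P * (1 - P⁻¹ * H) := by
    rw [Matrix.mul_sub, Matrix.mul_one, ← Matrix.mul_assoc, Matrix.mul_nonsing_inv _ hPu, Matrix.one_mul]
  have h2 : (1 - CFC.sqrt P⁻¹ * H * CFC.sqrt P⁻¹).det = (1 - P⁻¹ * H).det := by
    rw [Matrix.mul_assoc, Matrix.det_one_sub_mul_comm, Matrix.mul_assoc, sqrt_inv_mul_sqrt_inv hP,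
      Matrix.det_one_sub_mul_comm]
  rw [h1, det_mul, h2]

/-- The operator form behind (II.2.100): `P − H = P^{1/2}(I − P^{−1/2}HP^{−1/2})P^{1/2}`. [cite: Balaban1982Higgs2, (2.100) p.577] -/
theorem sub_eq_sqrt_conj (hP : P.PosDef) (H : Matrix ι ι ℝ) :
    P - H = CFC.sqrt P * (1 - CFC.sqrt P⁻¹ * H * CFC.sqrt P⁻¹) * CFC.sqrt P := by
  rw [Matrix.mul_sub, Matrix.sub_mul, Matrix.mul_one, sqrt_mul_sqrt hP]
  congr 1
  calc H = (CFC.sqrt P * CFC.sqrt P⁻¹) * H * (CFC.sqrt P⁻¹ * CFC.sqrt P) := by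
        rw [sqrt_mul_sqrt_inv hP, sqrt_inv_mul_sqrt hP, Matrix.one_mul, Matrix.mul_one]
    _ = CFC.sqrt P * (CFC.sqrt P⁻¹ * H * CFC.sqrt P⁻¹) * CFC.sqrt P := by simp only [Matrix.mul_assoc]

/-- `I − P^{−1/2}HP^{−1/2} = P^{−1/2}(P − H)P^{−1/2}` (the middle equality of (II.2.102)). [cite: Balaban1982Higgs2, (2.102) p.577] -/
theorem one_sub_conj_eq (hP : P.PosDef) (H : Matrix ι ι ℝ) :
    1 - CFC.sqrt P⁻¹ * H * CFC.sqrt P⁻¹ = CFC.sqrt P⁻¹ * (P - H) * CFC.sqrt P⁻¹ := by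
  rw [Matrix.mul_sub, Matrix.sub_mul, sqrt_inv_conj_self hP]

/-- *"Obviously the operators standing in the above determinants are positive"*: `P ≻ 0` and `P − H ≻ 0` give
`I − P^{−1/2}HP^{−1/2} ≻ 0`. [cite: Balaban1982Higgs1, (3.46) p.620] -/
theorem posDef_one_sub_conj (hP : P.PosDef) {H : Matrix ι ι ℝ} (hPH : (P - H).PosDef) :
    (1 - CFC.sqrt P⁻¹ * H * CFC.sqrt P⁻¹).PosDef := by
  rw [one_sub_conj_eq hP H]
  have h := hPH.conjTranspose_mul_mul_same (B := CFC.sqrt P⁻¹) (Matrix.mulVec_injective_of_isUnit (isUnit_sqrt hP.inv))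
  rwa [(isHermitian_sqrt _).eq] at h

/-- *"… and symmetric"*: `P^{−1/2}HP^{−1/2}` is symmetric for symmetric `H`. [cite: Balaban1982Higgs1, (3.46) p.620] -/
theorem isHermitian_conj {H : Matrix ι ι ℝ} (hH : H.IsHermitian) (P : Matrix ι ι ℝ) :
    (CFC.sqrt P⁻¹ * H * CFC.sqrt P⁻¹).IsHermitian := by
  have h := isHermitian_conjTranspose_mul_mul (CFC.sqrt P⁻¹) hH
  rwa [(isHermitian_sqrt _).eq] at h

/-- Inverse Loewner bound (the use of *"Proposition I.2.3"* in (II.2.102)): `C ≻ 0`, `C ≦ γ₁I`, `γ₁ > 0` ⇒ `γ₁⁻¹I ≦ C⁻¹`.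
[cite: Balaban1982Higgs2, (2.102) p.577] -/
theorem inv_lower {C : Matrix ι ι ℝ} (hC : C.PosDef) {γ₁ : ℝ} (hγ₁ : 0 < γ₁)
    (h : (γ₁ • (1 : Matrix ι ι ℝ) - C).PosSemidef) : (C⁻¹ - γ₁⁻¹ • (1 : Matrix ι ι ℝ)).PosSemidef := by
  have h1 := h.conjTranspose_mul_mul_same (CFC.sqrt C⁻¹)
  rw [(isHermitian_sqrt _).eq, Matrix.mul_sub, Matrix.sub_mul, Matrix.mul_smul, Matrix.smul_mul, Matrix.mul_one,
    sqrt_inv_mul_sqrt_inv hC, sqrt_inv_conj_self hC] at h1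
  have h2 := h1.smul (inv_pos.2 hγ₁).le
  rwa [smul_sub, smul_smul, inv_mul_cancel₀ hγ₁.ne', one_smul] at h2

/-- Inverse Loewner bound: `C ≻ 0`, `γ₀I ≦ C`, `γ₀ > 0` ⇒ `C⁻¹ ≦ γ₀⁻¹I`. [cite: Balaban1982Higgs2, (2.102) p.577] -/
theorem inv_upper {C : Matrix ι ι ℝ} (hC : C.PosDef) {γ₀ : ℝ} (hγ₀ : 0 < γ₀)
    (h : (C - γ₀ • (1 : Matrix ι ι ℝ)).PosSemidef) : (γ₀⁻¹ • (1 : Matrix ι ι ℝ) - C⁻¹).PosSemidef := by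
  have h1 := h.conjTranspose_mul_mul_same (CFC.sqrt C⁻¹)
  rw [(isHermitian_sqrt _).eq, Matrix.mul_sub, Matrix.sub_mul, Matrix.mul_smul, Matrix.smul_mul, Matrix.mul_one,
    sqrt_inv_mul_sqrt_inv hC, sqrt_inv_conj_self hC] at h1
  have h2 := h1.smul (inv_pos.2 hγ₀).le
  rwa [smul_sub, smul_smul, inv_mul_cancel₀ hγ₀.ne', one_smul] at h2

end Engine

/-! ## §2 [Balaban1982Higgs1] (3.46)–(3.47) p. 620: `G₀` ↤ `G_k(B^{(k+1)})`, `G₁` ↤ `G_k(A′^{(k)} + B^{(k+1)})`, `V` ↤ `V_k`,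
related by (3.16)/(3.44): `G₁⁻¹ = G₀⁻¹ − V` -/

section Eq346

variable {G₀ G₁ V : Matrix ι ι ℝ}

/-- **(3.46)** p. 620, determinant form: `det G₁⁻¹ = det G₀⁻¹ · det(I − G₀^{1/2}VG₀^{1/2})` (*"Using the formula (3.16)"*:
hypothesis `G₁⁻¹ = G₀⁻¹ − V`). [cite: Balaban1982Higgs1, (3.46) p.620] -/
theorem eq346_det (hG₀ : G₀.PosDef) (hV : G₁⁻¹ = G₀⁻¹ - V) :
    (G₁⁻¹).det = (G₀⁻¹).det * (1 - CFC.sqrt G₀ * V * CFC.sqrt G₀).det := by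
  have h := det_sub_eq hG₀.inv V
  rwa [Matrix.nonsing_inv_nonsing_inv _ ((Matrix.isUnit_iff_isUnit_det _).1 hG₀.isUnit), ← hV] at h

/-- p. 620, *"Obviously the operators standing in the above determinants are positive"*: with both propagators positive
(`G₀, G₁ ≻ 0`), `I − G₀^{1/2}VG₀^{1/2} = G₀^{1/2}G₁⁻¹G₀^{1/2} ≻ 0`. [cite: Balaban1982Higgs1, (3.46) p.620] -/
theorem posDef_one_sub346 (hG₀ : G₀.PosDef) (hG₁ : G₁.PosDef) (hV : G₁⁻¹ = G₀⁻¹ - V) :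
    (1 - CFC.sqrt G₀ * V * CFC.sqrt G₀).PosDef := by
  have h := posDef_one_sub_conj hG₀.inv (H := V) (by rw [← hV]; exact hG₁.inv)
  rwa [Matrix.nonsing_inv_nonsing_inv _ ((Matrix.isUnit_iff_isUnit_det _).1 hG₀.isUnit)] at h

/-- p. 620, *"… and symmetric"*: `V = G₀⁻¹ − G₁⁻¹` and `K = G₀^{1/2}VG₀^{1/2}` are symmetric. [cite: Balaban1982Higgs1, (3.46) p.620] -/
theorem isHermitian_K346 (hG₀ : G₀.PosDef) (hG₁ : G₁.PosDef) (hV : G₁⁻¹ = G₀⁻¹ - V) :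
    V.IsHermitian ∧ (CFC.sqrt G₀ * V * CFC.sqrt G₀).IsHermitian := by
  have hVe : V = G₀⁻¹ - G₁⁻¹ := by rw [hV]; abel
  have hVh : V.IsHermitian := by rw [hVe]; exact hG₀.inv.isHermitian.sub hG₁.inv.isHermitian
  refine ⟨hVh, ?_⟩
  have h := isHermitian_conj hVh G₀⁻¹
  rwa [Matrix.nonsing_inv_nonsing_inv _ ((Matrix.isUnit_iff_isUnit_det _).1 hG₀.isUnit)] at h

/-- **(3.46)** p. 620 AS PRINTED: `(det G₁⁻¹)^{−1/2} = (det G₀⁻¹)^{−1/2}[det(I − G₀^{1/2}VG₀^{1/2})]^{−1/2}` (real powers of the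
two positive determinants). [cite: Balaban1982Higgs1, (3.46) p.620] -/
theorem eq346 (hG₀ : G₀.PosDef) (hG₁ : G₁.PosDef) (hV : G₁⁻¹ = G₀⁻¹ - V) :
    (G₁⁻¹).det ^ (-(1 / 2 : ℝ)) =
      (G₀⁻¹).det ^ (-(1 / 2 : ℝ)) * (1 - CFC.sqrt G₀ * V * CFC.sqrt G₀).det ^ (-(1 / 2 : ℝ)) := by
  rw [eq346_det hG₀ hV]
  exact Real.mul_rpow hG₀.inv.det_pos.le (posDef_one_sub346 hG₀ hG₁ hV).det_pos.le

/-- Cyclicity for (3.47): `Tr(G₀V)^m = Tr(G₀^{1/2}VG₀^{1/2})^m`. [cite: Balaban1982Higgs1, (3.47) p.620] -/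
theorem trace_pow_eq346 (hG₀ : G₀.PosDef) (V : Matrix ι ι ℝ) (m : ℕ) :
    ((G₀ * V) ^ m).trace = ((CFC.sqrt G₀ * V * CFC.sqrt G₀) ^ m).trace := by
  conv_lhs => rw [← sqrt_mul_sqrt hG₀, Matrix.mul_assoc]
  rw [trace_mul_pow_comm]

end Eq346

section Ineq347

variable {ι : Type} [Fintype ι] [DecidableEq ι] {G₀ G₁ V : Matrix ι ι ℝ}

/-- **(3.47)** p. 620 in its PRINTED trace form: for `G₀, G₁ ≻ 0` with `G₁⁻¹ = G₀⁻¹ − V` and `n` odd,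
`[det(I − G₀^{1/2}VG₀^{1/2})]^{−1/2} ≧ exp Σ_{j=1}^{n} (1/2j) Tr(G₀V)^j` — r12's `B1Sect3Statements.ineq347_of_posDef` (the
predicate `B1LowerBound.Ineq347`, exponent `Tr K^j`) composed with the positivity of p. 620 and cyclicity. [cite: Balaban1982Higgs1, (3.47) p.620] -/
theorem ineq347_printed (hG₀ : G₀.PosDef) (hG₁ : G₁.PosDef) (hV : G₁⁻¹ = G₀⁻¹ - V) {n : ℕ} (hn : Odd n) :
    Real.exp (∑ j ∈ range n, (1 / (2 * ((j : ℝ) + 1))) * ((G₀ * V) ^ (j + 1)).trace) ≤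
      (1 - CFC.sqrt G₀ * V * CFC.sqrt G₀).det ^ (-(1 / 2 : ℝ)) := by
  have h := B1Sect3Statements.ineq347_of_posDef (posDef_one_sub346 hG₀ hG₁ hV) hn
  unfold B1LowerBound.Ineq347 at h
  simpa only [trace_pow_eq346 hG₀ V] using h

/-- (3.46) with (3.47) inserted — the lower bound for the factor `(det G_k⁻¹(A′^{(k)} + B^{(k+1)}))^{−1/2}` of `Z_k(A^{(k)})` (3.40):
`(det G₁⁻¹)^{−1/2} ≧ (det G₀⁻¹)^{−1/2} exp Σ_{j=1}^{n} (1/2j) Tr(G₀V)^j`. [cite: Balaban1982Higgs1, (3.46)–(3.47) p.620] -/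
theorem eq346_ineq347 (hG₀ : G₀.PosDef) (hG₁ : G₁.PosDef) (hV : G₁⁻¹ = G₀⁻¹ - V) {n : ℕ} (hn : Odd n) :
    (G₀⁻¹).det ^ (-(1 / 2 : ℝ)) * Real.exp (∑ j ∈ range n, (1 / (2 * ((j : ℝ) + 1))) * ((G₀ * V) ^ (j + 1)).trace) ≤
      (G₁⁻¹).det ^ (-(1 / 2 : ℝ)) := by
  rw [eq346 hG₀ hG₁ hV]
  exact mul_le_mul_of_nonneg_left (ineq347_printed hG₀ hG₁ hV hn) (Real.rpow_nonneg hG₀.inv.det_pos.le _)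

end Ineq347

/-! ## §3 [Balaban1982Higgs2] (2.100)–(2.102) p. 577: `C₀` ↤ `C(B̃)`, `C₁` ↤ `C(B̃ + Ã)`, `W` ↤ `W^{(j)}(Ã,B̃)`, related by
(2.99): `C₁⁻¹ = C₀⁻¹ − W` -/

section Eq2100

variable {C₀ C₁ W : Matrix ι ι ℝ}

/-- **(2.100)** p. 577: `C₁⁻¹ = C₀^{−1/2}(I − C₀^{1/2}WC₀^{1/2})C₀^{−1/2}`. [cite: Balaban1982Higgs2, (2.100) p.577] -/
theorem eq2100 (hC₀ : C₀.PosDef) (hW : C₁⁻¹ = C₀⁻¹ - W) :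
    C₁⁻¹ = CFC.sqrt C₀⁻¹ * (1 - CFC.sqrt C₀ * W * CFC.sqrt C₀) * CFC.sqrt C₀⁻¹ := by
  have h := sub_eq_sqrt_conj hC₀.inv W
  rwa [Matrix.nonsing_inv_nonsing_inv _ ((Matrix.isUnit_iff_isUnit_det _).1 hC₀.isUnit), ← hW] at h

/-- **(2.101)** p. 577: `[det C₁⁻¹]^{−1/2} = [det C₀⁻¹]^{−1/2}·[det(I − C₀^{1/2}WC₀^{1/2})]^{−1/2}` (both propagators positive).
[cite: Balaban1982Higgs2, (2.101) p.577] -/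
theorem eq2101 (hC₀ : C₀.PosDef) (hC₁ : C₁.PosDef) (hW : C₁⁻¹ = C₀⁻¹ - W) :
    (C₁⁻¹).det ^ (-(1 / 2 : ℝ)) =
      (C₀⁻¹).det ^ (-(1 / 2 : ℝ)) * (1 - CFC.sqrt C₀ * W * CFC.sqrt C₀).det ^ (-(1 / 2 : ℝ)) :=
  eq346 hC₀ hC₁ hW

/-- **(2.102)** p. 577, the middle equality: `I − C₀^{1/2}WC₀^{1/2} = C₀^{1/2}C₁⁻¹C₀^{1/2}`. [cite: Balaban1982Higgs2, (2.102) p.577] -/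
theorem eq2102 (hC₀ : C₀.PosDef) (hW : C₁⁻¹ = C₀⁻¹ - W) :
    1 - CFC.sqrt C₀ * W * CFC.sqrt C₀ = CFC.sqrt C₀ * C₁⁻¹ * CFC.sqrt C₀ := by
  have h := one_sub_conj_eq hC₀.inv W
  rwa [Matrix.nonsing_inv_nonsing_inv _ ((Matrix.isUnit_iff_isUnit_det _).1 hC₀.isUnit), ← hW] at h

/-- **(2.102)** p. 577: *"we can apply Proposition I.2.3 and we get (γ₀/γ₁)I ≦ C₀^{1/2}C₁⁻¹C₀^{1/2} ≦ (γ₁/γ₀)I"* — PROVED from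
the two-sided bounds `γ₀I ≦ C₀, C₁ ≦ γ₁I` (`0 < γ₀, γ₁`) that Proposition I.2.3 supplies for both propagators.
[cite: Balaban1982Higgs2, (2.102) p.577] -/
theorem ineq2102 (hC₀ : C₀.PosDef) (hC₁ : C₁.PosDef) {γ₀ γ₁ : ℝ} (hγ₀ : 0 < γ₀) (hγ₁ : 0 < γ₁)
    (h₀l : (C₀ - γ₀ • (1 : Matrix ι ι ℝ)).PosSemidef) (h₀u : (γ₁ • (1 : Matrix ι ι ℝ) - C₀).PosSemidef)
    (h₁l : (C₁ - γ₀ • (1 : Matrix ι ι ℝ)).PosSemidef) (h₁u : (γ₁ • (1 : Matrix ι ι ℝ) - C₁).PosSemidef) :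
    (CFC.sqrt C₀ * C₁⁻¹ * CFC.sqrt C₀ - (γ₀ / γ₁) • (1 : Matrix ι ι ℝ)).PosSemidef ∧
      ((γ₁ / γ₀) • (1 : Matrix ι ι ℝ) - CFC.sqrt C₀ * C₁⁻¹ * CFC.sqrt C₀).PosSemidef := by
  have hT : (CFC.sqrt C₀)ᴴ = CFC.sqrt C₀ := (isHermitian_sqrt _).eq
  constructor
  · -- lower bound: C₁⁻¹ ≧ γ₁⁻¹ I, conjugated by C₀^{1/2}, plus γ₁⁻¹(C₀ − γ₀I) ≧ 0
    have h1 := (inv_lower hC₁ hγ₁ h₁u).conjTranspose_mul_mul_same (CFC.sqrt C₀)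
    rw [hT, Matrix.mul_sub, Matrix.sub_mul, Matrix.mul_smul, Matrix.smul_mul, Matrix.mul_one, sqrt_mul_sqrt hC₀] at h1
    have h2 := h₀l.smul (inv_pos.2 hγ₁).le
    rw [smul_sub, smul_smul] at h2
    have h3 := h1.add h2
    rwa [sub_add_sub_cancel, show γ₁⁻¹ * γ₀ = γ₀ / γ₁ by rw [div_eq_mul_inv, mul_comm]] at h3
  · -- upper bound: C₁⁻¹ ≦ γ₀⁻¹ I, conjugated, plus γ₀⁻¹(γ₁I − C₀) ≧ 0
    have h1 := (inv_upper hC₁ hγ₀ h₁l).conjTranspose_mul_mul_same (CFC.sqrt C₀)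
    rw [hT, Matrix.mul_sub, Matrix.sub_mul, Matrix.mul_smul, Matrix.smul_mul, Matrix.mul_one, sqrt_mul_sqrt hC₀] at h1
    have h2 := h₀u.smul (inv_pos.2 hγ₀).le
    rw [smul_sub, smul_smul] at h2
    have h3 := h2.add h1
    rwa [sub_add_sub_cancel, show γ₀⁻¹ * γ₁ = γ₁ / γ₀ by rw [div_eq_mul_inv, mul_comm]] at h3

end Eq2100

/-! ## §4 [Balaban1982Higgs2] (3.18) p. 586: `G′` ↤ `G′_k`, `H′` ↤ `H′_k`; `G′^{−1/2} = CFC.sqrt G′⁻¹` -/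

section Eq318

variable {G' H' : Matrix ι ι ℝ}

/-- **(3.18)** p. 586, determinant form: `det(G′ − H′) = det G′ · det(I − G′^{−1/2}H′G′^{−1/2})`. [cite: Balaban1982Higgs2, (3.18) p.586] -/
theorem eq318_det (hG : G'.PosDef) (H' : Matrix ι ι ℝ) :
    (G' - H').det = G'.det * (1 - CFC.sqrt G'⁻¹ * H' * CFC.sqrt G'⁻¹).det :=
  det_sub_eq hG H'

/-- **(3.18)** p. 586 AS PRINTED: `[det(G′ − H′)]^{−1/2} = (det G′)^{−1/2}[det(I − G′^{−1/2}H′G′^{−1/2})]^{−1/2}` for `G′ ≻ 0` and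
`G′ − H′ ≻ 0` (p. 586: *"the operators G′_k − H′_k and G″_k − H″_k are positive"*). [cite: Balaban1982Higgs2, (3.18) p.586] -/
theorem eq318 (hG : G'.PosDef) (hGH : (G' - H').PosDef) :
    (G' - H').det ^ (-(1 / 2 : ℝ)) =
      G'.det ^ (-(1 / 2 : ℝ)) * (1 - CFC.sqrt G'⁻¹ * H' * CFC.sqrt G'⁻¹).det ^ (-(1 / 2 : ℝ)) := by
  rw [eq318_det hG H']
  exact Real.mul_rpow hG.det_pos.le (posDef_one_sub_conj hG hGH).det_pos.le

end Eq318

/-! ## §5 (v1.1) p. 620, *"Taking into account the form (3.40) of this factor"*: the factor `Z_k(A^{(k)})` through (3.46) -/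

section Factor340

variable {G₀ G₁ V : Matrix ι ι ℝ}

/-- p. 620 [PDF 18], the sentence before (3.46): *"The formulas (3.14)–(3.16), (3.44), and (3.45) are sufficient to expand all
the expressions in the action S^{(k)}, except the factor Z_k(A^{(k)}). Taking into account the form (3.40) of this factor it
is sufficient to find an expansion of (det G_k⁻¹(A′^{(k)} + B^{(k+1)}))^{−1/2}."* — THEOREM: the normalised Gaussian constant
`(c/2π)^{n/2}∫exp(−½⟨v,Mv⟩)dv = c^{n/2}/√(det M)` ((3.32)/(3.40), `B1GaussNorm331.gaussNorm_eq`) at `M = G₁⁻¹` equals the one at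
`M = G₀⁻¹` times the second factor of (3.46). [cite: Balaban1982Higgs1, (3.40)/(3.46) pp.619–620] -/
theorem gaussNorm_eq346 (hG₀ : G₀.PosDef) (hG₁ : G₁.PosDef) (hV : G₁⁻¹ = G₀⁻¹ - V) {c : ℝ} (hc : 0 ≤ c) :
    B1GaussNorm331.gaussNorm c G₁⁻¹ =
      B1GaussNorm331.gaussNorm c G₀⁻¹ * (1 - CFC.sqrt G₀ * V * CFC.sqrt G₀).det ^ (-(1 / 2 : ℝ)) := by
  have key : ∀ {x : ℝ}, 0 < x → ∀ a : ℝ, a / Real.sqrt x = a * x ^ (-(1 / 2 : ℝ)) := fun {x} hx a => by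
    rw [div_eq_mul_inv a (Real.sqrt x), Real.sqrt_eq_rpow, Real.rpow_neg hx.le]
  rw [B1GaussNorm331.gaussNorm_eq hc hG₁.inv, B1GaussNorm331.gaussNorm_eq hc hG₀.inv, key hG₁.inv.det_pos,
    key hG₀.inv.det_pos, eq346 hG₀ hG₁ hV]
  ring

/-- The same for the printed `Z_k(A^{(k),ε})` of (3.32) (`B1GaussNorm331.ZkA`, index `T₁^{(k)} × {1,…,N}`, prefactor base
`a_k(L^kε)^{d−2}`): `Z_k(A′^{(k)} + B^{(k+1)}) = Z_k(B^{(k+1)})·[det(I − G₀^{1/2}V_kG₀^{1/2})]^{−1/2}` for `a_k ≥ 0`, `L^kε > 0`.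
[cite: Balaban1982Higgs1, (3.40)/(3.46) pp.619–620] -/
theorem ZkA_eq346 {T : Type*} [Fintype T] [DecidableEq T] (d N : ℕ) {ak ℓ : ℝ} (hak : 0 ≤ ak) (hℓ : 0 < ℓ)
    {G₀ G₁ V : Matrix (T × Fin N) (T × Fin N) ℝ} (hG₀ : G₀.PosDef) (hG₁ : G₁.PosDef) (hV : G₁⁻¹ = G₀⁻¹ - V) :
    B1GaussNorm331.ZkA d N ak ℓ G₁⁻¹ =
      B1GaussNorm331.ZkA d N ak ℓ G₀⁻¹ * (1 - CFC.sqrt G₀ * V * CFC.sqrt G₀).det ^ (-(1 / 2 : ℝ)) := by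
  have hc : 0 ≤ B1RT.prec ak ℓ d := mul_nonneg hak (zpow_pos hℓ _).le
  rw [B1GaussNorm331.ZkA_eq_gaussNorm, B1GaussNorm331.ZkA_eq_gaussNorm, gaussNorm_eq346 hG₀ hG₁ hV hc]

end Factor340

section Factor340Ineq

variable {ι : Type} [Fintype ι] [DecidableEq ι] {G₀ G₁ V : Matrix ι ι ℝ}

/-- With (3.47): `Z_k(A′^{(k)} + B^{(k+1)}) ≧ Z_k(B^{(k+1)})·exp Σ_{j=1}^{n}(1/2j)Tr(G₀V_k)^j` (`n` odd) — the lower bound the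
expansion of the factor `Z_k(A^{(k)})` contributes to the fundamental inequality. [cite: Balaban1982Higgs1, (3.46)–(3.47) p.620] -/
theorem gaussNorm_ineq347 (hG₀ : G₀.PosDef) (hG₁ : G₁.PosDef) (hV : G₁⁻¹ = G₀⁻¹ - V) {c : ℝ} (hc : 0 ≤ c) {n : ℕ}
    (hn : Odd n) :
    B1GaussNorm331.gaussNorm c G₀⁻¹ * Real.exp (∑ j ∈ range n, (1 / (2 * ((j : ℝ) + 1))) * ((G₀ * V) ^ (j + 1)).trace) ≤
      B1GaussNorm331.gaussNorm c G₁⁻¹ := by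
  rw [gaussNorm_eq346 hG₀ hG₁ hV hc]
  refine mul_le_mul_of_nonneg_left (ineq347_printed hG₀ hG₁ hV hn) ?_
  rw [B1GaussNorm331.gaussNorm_eq hc hG₀.inv]
  exact div_nonneg (Real.rpow_nonneg hc _) (Real.sqrt_nonneg _)

end Factor340Ineq

/-! ## §6 (v1.2) [Balaban1982Higgs1] (3.69) p. 625 for the printed, non-symmetric operator `a_K(L^Kε)^{d−2}P_KG^ε` -/

section Ineq369Printed

variable {G P : Matrix ι ι ℝ}

/-- `det(I + PG) = det(I + G^{1/2}PG^{1/2})` for `G ≻ 0` (the conjugation making the printed operator of (3.69) symmetric).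
[cite: Balaban1982Higgs1, (3.69) p.625] -/
theorem det_one_add_mul_eq (hG : G.PosDef) (P : Matrix ι ι ℝ) :
    (1 + P * G).det = (1 + CFC.sqrt G * P * CFC.sqrt G).det := by
  conv_lhs => rw [← sqrt_mul_sqrt hG, ← Matrix.mul_assoc, Matrix.det_one_add_mul_comm, ← Matrix.mul_assoc]

/-- `Tr(PG) = Tr(G^{1/2}PG^{1/2})` for `G ≻ 0`. [cite: Balaban1982Higgs1, (3.69) p.625] -/
theorem trace_mul_eq (hG : G.PosDef) (P : Matrix ι ι ℝ) :
    (P * G).trace = (CFC.sqrt G * P * CFC.sqrt G).trace := by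
  conv_lhs => rw [← sqrt_mul_sqrt hG, ← Matrix.mul_assoc, Matrix.trace_mul_comm, ← Matrix.mul_assoc]

/-- `G^{1/2}PG^{1/2} ⪰ 0` for `P ⪰ 0` (*"Obviously … positive and symmetric"*). [cite: Balaban1982Higgs1, (3.69) p.625] -/
theorem posSemidef_sqrt_conj (hP : P.PosSemidef) (G : Matrix ι ι ℝ) :
    (CFC.sqrt G * P * CFC.sqrt G).PosSemidef := by
  have h := hP.conjTranspose_mul_mul_same (CFC.sqrt G)
  rwa [(isHermitian_sqrt G).eq] at h

/-- **(3.69)** p. 625 [PDF 23], *"[det(I + a_K(L^Kε)^{d−2}P_KG^ε)]^{−1/2}·[det(I + a_K(L^Kε)^{d−2}P_KG^ε(0))]^{−1/2}exp(O(1)|T_ε|) ≧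
exp[−½a_K(L^Kε)^{d−2}(Tr P_KG^ε + Tr P_KG^ε(0)) + O(1)|T_ε|]"* — the predicate `B1Sect3Statements.Ineq369`
(`det(I + X)^{−1/2} ≧ exp(−½Tr X)`, typed by r12 for ONE matrix `X ↤ a_K(L^Kε)^{d−2}P_KG^ε`) PROVED for the printed shape
`X = a·P·G` with `G ≻ 0` (↤ `G^ε`, resp. `G^ε(0)`), `P ⪰ 0` (↤ `P_K = Q_K^*Q_K`), `a ≥ 0` (↤ `a_K(L^Kε)^{d−2}`): such `X` is not symmetric,
but `det(I + X) = det(I + aG^{1/2}PG^{1/2})`, `Tr X = Tr(aG^{1/2}PG^{1/2})` and `aG^{1/2}PG^{1/2} ⪰ 0` is, so r12's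
`ineq369_of_posSemidef` applies. [cite: Balaban1982Higgs1, (3.69) p.625] -/
theorem ineq369_printed (hG : G.PosDef) (hP : P.PosSemidef) {a : ℝ} (ha : 0 ≤ a) :
    B1Sect3Statements.Ineq369 (a • (P * G)) := by
  have hX : (a • (CFC.sqrt G * P * CFC.sqrt G)).PosSemidef := (posSemidef_sqrt_conj hP G).smul ha
  have h := B1Sect3Statements.ineq369_of_posSemidef hX
  unfold B1Sect3Statements.Ineq369 at h ⊢
  have htr : (a • (P * G)).trace = (a • (CFC.sqrt G * P * CFC.sqrt G)).trace := by
    rw [trace_smul, trace_smul, trace_mul_eq hG P]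
  have hdet : (1 + a • (P * G)).det = (1 + a • (CFC.sqrt G * P * CFC.sqrt G)).det := by
    rw [← Matrix.smul_mul, det_one_add_mul_eq hG (a • P), Matrix.mul_smul, Matrix.smul_mul]
  rwa [htr, hdet]

end Ineq369Printed

end Literature.MathematicalPhysics.QuantumFieldTheory.Balaban1983to89.B1Eq346DetFactorization
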